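import Summits.ValiantsHypothesis.ValiantsHypothesis.Theorems.KPlusLogSqLawTropicalBRefreshExclusivity

/-!
# Route «KPlusLogSqLaw», crux `TropicalB` (stmt-ValiantsHypothesis-19771) — the TIGHT-ENTRY LAWS of a dominant chain:
# «a tight entry is a first entry» and «every other entry into the same (cell, class) BRACKETS the tight one, with its
# off-column exponent mass jumping across»

HONEST FRAMING.  Helper toward the registered stubs `stub_tropThin` / `stub_tropFat` of `Cruxes/TropicalB/Lines/birth.lean`
(crux `Summit.ValiantsHypothesis.ValiantsHypothesis.Theses.KPlusLogSqLaw.TropicalB`, ledger item `stmt-ValiantsHypothesis-19771`,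
route `KPlusLogSqLaw`; cell `pub-symmetroid`, seat val-sym-trop-p3 g16, 2026-08-29; `--supports … --as helper`).  STRUCTURAL facts
about dominant chains (unique optima at strictly increasing integer slopes) of an ARBITRARY dominance design of any format `(m, K)`,
sharpening the rotation lemma / refresh exclusivity of `…TropicalBRefreshExclusivity` (val-sym-trop-p4 g4).  They live in the
small-format corner «fixed `m`, all `K`» of this seat's docket (the `m = 3` row: `10K − 42 ≤ T_D(3,K) ≤ ⌊(27K−17)/2⌋` of record);
nothing here bears on `TropicalB` in its window `⌊log₂ m⌋ + 1 < K < m`, on `WeakLifting`, the doors, `MatrixDescartes`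
(stmt-ValiantsHypothesis-18050) or VP ≠ VNP.

VOCABULARY (as in the companion file).  Along a chain `p 0, …, p n`, a TIGHT PAIR of the permutation `σ` at column `b` is a pair of
positions `i < k` both carrying `σ`, whose class vectors agree off `b` and differ at `b`; the cell `e = (σ b, b)` then ENTERS the class
`c = (p k).2 b` at position `k`.  A STEP of `σ'` is a pair `i' < k'` of consecutive uses of `σ'`.

* `d_lt_of_tight_entry` — **A TIGHT ENTRY IS A FIRST ENTRY.**  If `(i, k)` is a tight STEP of `σ` at column `b`, then every earlier
  position `j < k` whose permutation passes through the cell `e` (ANY permutation) carries there a class of strictly smaller exponent than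
  `c`.  (Cell monotonicity up to `i`, the rotation lemma `no_foreign_between` strictly between `i` and `k`.)  Refresh exclusivity
  («two tight steps into the same (cell, class) coincide») is the special case of two tight entries.
* `lt_of_entry_after_tight` / `lt_of_entry_before_tight` — **BRACKETING.**  If `(i, k)` is a tight pair of `σ` at `b` entering `c`, and
  `i' < k'` are two positions of ANOTHER permutation `σ' ≠ σ` through the same cell (`σ' b = σ b`) whose class at `b` changes from
  `(p i').2 b ≠ c` to `(p k').2 b = c`, then `k < k'` and `i' < i`: the other permutation's entering move spans the tight one.
* `offMass_bracket` — **THE OFF-COLUMN MASS JUMPS ACROSS.**  In that situation the exponent mass off column `b`,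
  `Σ_{x ≠ b} d ((p ·).2 x)`, satisfies `off(p i') < off(p i) = off(p k) < off(p k')` (one-column exchange inequality
  `erase_sum_lt_of_dominant` at the two ends; tightness in the middle).

READING (docstring only; located, not claimed — seat memo M3-ROW-LAWMAX-g16.md).  For `m = 3` every cell lies on exactly two
permutations (one of each parity), so each (cell, class) has at most two entries, at most one of them tight, and a non-tight entry of the
partner is a double or triple step that spans the tight one with its two-column exponent mass jumping across the tight step's constant
value.  Under super-increasing exponents this forces, for a double step both of whose entries are tight-entered by the partners, the fixed
column to end strictly below both moved columns unless a class is skipped — the mechanism behind the located fact that period-one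
`(3, K)` schedules obeying the pairwise exchange laws carry at most `12` terms per class level (profile `(3,3,3,1,1,1)`), against the
half-thin ceiling `13.5`.  No counting consequence is formalised in this file.
[this cell; the exchange inequality is folklore]
-/

-- `Summit.ValiantsHypothesis.ValiantsHypothesis.…` repeats a component by the D-0017 layout
-- (single-conjunct summit), which the `dupNamespace` linter flags; the name is mandated.
set_option linter.dupNamespace false
set_option autoImplicit false

namespace Summit.ValiantsHypothesis.ValiantsHypothesis.Theorems.KPlusLogSqLaw

open Summit.ValiantsHypothesis.ValiantsHypothesis.Theorems.MatrixDescartes.Negative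
open Summit.ValiantsHypothesis.ValiantsHypothesis.Theorems.LacunarySymmetroidMatrixDescartes.TropicalCensus
open Finset

namespace RefreshExclusivity

section Chain

variable {m K n : ℕ} (d : Fin K → ℕ) (v ε : Fin m → Fin m → Fin K → ℤ) (θ : Fin (n + 1) → ℤ)
  (p : Fin (n + 1) → Equiv.Perm (Fin m) × (Fin m → Fin K))

/-- **A TIGHT ENTRY IS A FIRST ENTRY.**  Let `(i, k)` be a tight step of the permutation `σ = (p k).1` at column `b` (same permutation
at `i < k`, no use of `σ` strictly between, class vectors equal off `b` and different at `b`).  Then every position `j < k` whose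
permutation uses `σ`'s row at column `b` carries there a class of strictly smaller exponent than the entered class `(p k).2 b`.
[this cell] -/
theorem d_lt_of_tight_entry (hθ : StrictMono θ) (hdom : ∀ k, IsDominant d v ε (θ k) (p k))
    {i k j : Fin (n + 1)} (b : Fin m)
    (hik : i < k) (hpi : (p i).1 = (p k).1) (hbtw : ∀ j', i < j' → j' < k → (p j').1 ≠ (p k).1)
    (hoff : ∀ b', b' ≠ b → (p i).2 b' = (p k).2 b') (hchg : (p i).2 b ≠ (p k).2 b)
    (hjk : j < k) (hcell : (p j).1 b = (p k).1 b) : d ((p j).2 b) < d ((p k).2 b) := by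
  have hstep : d ((p i).2 b) < d ((p k).2 b) := d_lt_of_cell d v ε θ p hθ hdom hik b (by rw [hpi]) hchg
  rcases le_or_gt j i with hji | hji
  · -- `j ≤ i`: cell monotonicity up to `i`, then the tight step itself
    exact (d_le_of_cell d v ε θ p hθ hdom hji b (by rw [hpi, hcell])).trans_lt hstep
  · -- `i < j < k`: `j` carries a foreign permutation through the cell — excluded by the rotation lemma
    exfalso
    have hj : (p j).1 ≠ (p i).1 := by rw [hpi]; exact hbtw j hji hjk
    exact no_foreign_between d v ε θ p hθ hdom hji hjk hpi b hoff (by rw [hcell, hpi]) hj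

/-- Refresh exclusivity from the first-entry law (the companion file's `refresh_exclusive`, re-derived in two lines): two tight steps
`(i, k)`, `(i', k')` at the same cell entering the same class have `k = k'`. [this cell] -/
theorem tight_entries_eq (hθ : StrictMono θ) (hdom : ∀ k, IsDominant d v ε (θ k) (p k))
    {i k i' k' : Fin (n + 1)} (b : Fin m)
    (hik : i < k) (hpi : (p i).1 = (p k).1) (hbtw : ∀ j, i < j → j < k → (p j).1 ≠ (p k).1)
    (hoff : ∀ b', b' ≠ b → (p i).2 b' = (p k).2 b') (hchg : (p i).2 b ≠ (p k).2 b)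
    (hik' : i' < k') (hpi' : (p i').1 = (p k').1) (hbtw' : ∀ j, i' < j → j < k' → (p j).1 ≠ (p k').1)
    (hoff' : ∀ b', b' ≠ b → (p i').2 b' = (p k').2 b') (hchg' : (p i').2 b ≠ (p k').2 b)
    (hcell : (p k').1 b = (p k).1 b) (hcls : (p k').2 b = (p k).2 b) : k = k' := by
  by_contra hne
  rcases lt_or_gt_of_ne hne with h | h
  · have := d_lt_of_tight_entry d v ε θ p hθ hdom b hik' hpi' hbtw' hoff' hchg' h hcell.symm
    rw [hcls] at this
    exact lt_irrefl _ this
  · have := d_lt_of_tight_entry d v ε θ p hθ hdom b hik hpi hbtw hoff hchg h hcell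
    rw [hcls] at this
    exact lt_irrefl _ this

/-- **BRACKETING, later end.**  Let `(i, k)` be a tight PAIR of `σ = (p k).1` at column `b` (no step condition needed) and let `k'`
be a position with a DIFFERENT permutation through the same cell carrying there the entered class `(p k).2 b`.  Then `k < k'`.
[this cell] -/
theorem lt_of_entry_after_tight (hθ : StrictMono θ) (hdom : ∀ k, IsDominant d v ε (θ k) (p k))
    {i k k' : Fin (n + 1)} (b : Fin m)
    (hik : i < k) (hpi : (p i).1 = (p k).1)
    (hoff : ∀ b', b' ≠ b → (p i).2 b' = (p k).2 b') (hchg : (p i).2 b ≠ (p k).2 b)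
    (hσ : (p k').1 ≠ (p k).1) (hcell : (p k').1 b = (p k).1 b) (hcls : (p k').2 b = (p k).2 b) : k < k' := by
  have hstep : d ((p i).2 b) < d ((p k).2 b) := d_lt_of_cell d v ε θ p hθ hdom hik b (by rw [hpi]) hchg
  have hne : k' ≠ k := fun h => hσ (by rw [h])
  rcases lt_trichotomy k' k with h | h | h
  · exfalso
    rcases le_or_gt k' i with hki | hki
    · -- `k' ≤ i`: the cell already carries the entered class before the tight pair starts
      have h1 := d_le_of_cell d v ε θ p hθ hdom hki b (by rw [hpi, hcell])
      rw [hcls] at h1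
      exact lt_irrefl _ (h1.trans_lt hstep)
    · -- `i < k' < k`: rotation lemma
      exact no_foreign_between d v ε θ p hθ hdom hki h hpi b hoff (by rw [hcell, hpi]) (by rw [hpi]; exact hσ)
  · exact absurd h hne
  · exact h

/-- **BRACKETING, earlier end.**  Let `(i, k)` be a tight pair of `σ = (p k).1` at column `b`, and let `i' < k'` be two positions of
ANOTHER permutation `σ' ≠ σ` through the same cell whose class there changes between `i'` and `k'` and equals the entered class
`(p k).2 b` at `k'`.  Then `i' < i` (and `k < k'` by `lt_of_entry_after_tight`): the move of `σ'` into the class spans the tight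
pair. [this cell] -/
theorem lt_of_entry_before_tight (hθ : StrictMono θ) (hdom : ∀ k, IsDominant d v ε (θ k) (p k))
    {i k i' k' : Fin (n + 1)} (b : Fin m)
    (hik : i < k) (hpi : (p i).1 = (p k).1)
    (hoff : ∀ b', b' ≠ b → (p i).2 b' = (p k).2 b') (hchg : (p i).2 b ≠ (p k).2 b)
    (hik' : i' < k') (hpi' : (p i').1 = (p k').1) (hchg' : (p i').2 b ≠ (p k').2 b)
    (hσ : (p k').1 ≠ (p k).1) (hcell : (p k').1 b = (p k).1 b) (hcls : (p k').2 b = (p k).2 b) : i' < i := by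
  have hkk' : k < k' := lt_of_entry_after_tight d v ε θ p hθ hdom b hik hpi hoff hchg hσ hcell hcls
  have hne : i' ≠ i := by
    intro h
    apply hσ
    rw [← hpi', h, hpi]
  rcases lt_trichotomy i' i with h | h | h
  · exact h
  · exact absurd h hne
  · exfalso
    have hi'k : i' ≠ k := by
      intro h'
      apply hσ
      rw [← hpi', h']
    rcases lt_or_gt_of_ne hi'k with hlt | hgt
    · -- `i < i' < k`: rotation lemma
      exact no_foreign_between d v ε θ p hθ hdom h hlt hpi b hoff (by rw [hpi', hcell, hpi]) (by rw [hpi', hpi]; exact hσ)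
    · -- `k < i' < k'`: at `i'` the cell carries a class of exponent at least that at `k` (monotonicity) and strictly below
      -- that at `k'` (the class changes between `i'` and `k'`), contradicting `(p k').2 b = (p k).2 b`.
      have h1 := d_le_of_cell d v ε θ p hθ hdom hgt.le b (by rw [hpi', hcell])
      have h2 := d_lt_of_cell d v ε θ p hθ hdom hik' b (by rw [hpi']) hchg'
      rw [hcls] at h2
      exact lt_irrefl _ (h1.trans_lt h2)

/-- **THE OFF-COLUMN MASS JUMPS ACROSS A TIGHT ENTRY.**  In the situation of `lt_of_entry_before_tight` (tight pair `(i, k)` of `σ`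
at column `b`; positions `i' < k'` of `σ' ≠ σ` through the same cell, class at `b` changing to the entered class), the exponent mass
off column `b` satisfies `off (p i') < off (p i) = off (p k) < off (p k')`. [this cell] -/
theorem offMass_bracket (hθ : StrictMono θ) (hdom : ∀ k, IsDominant d v ε (θ k) (p k))
    {i k i' k' : Fin (n + 1)} (b : Fin m)
    (hik : i < k) (hpi : (p i).1 = (p k).1)
    (hoff : ∀ b', b' ≠ b → (p i).2 b' = (p k).2 b') (hchg : (p i).2 b ≠ (p k).2 b)
    (hik' : i' < k') (hpi' : (p i').1 = (p k').1) (hchg' : (p i').2 b ≠ (p k').2 b)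
    (hσ : (p k').1 ≠ (p k).1) (hcell : (p k').1 b = (p k).1 b) (hcls : (p k').2 b = (p k).2 b) :
    ∑ x ∈ univ.erase b, (d ((p i').2 x) : ℤ) < ∑ x ∈ univ.erase b, (d ((p i).2 x) : ℤ) ∧
      ∑ x ∈ univ.erase b, (d ((p i).2 x) : ℤ) = ∑ x ∈ univ.erase b, (d ((p k).2 x) : ℤ) ∧
      ∑ x ∈ univ.erase b, (d ((p k).2 x) : ℤ) < ∑ x ∈ univ.erase b, (d ((p k').2 x) : ℤ) := by
  have hkk' : k < k' := lt_of_entry_after_tight d v ε θ p hθ hdom b hik hpi hoff hchg hσ hcell hcls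
  have hii' : i' < i := lt_of_entry_before_tight d v ε θ p hθ hdom b hik hpi hoff hchg hik' hpi' hchg' hσ hcell hcls
  refine ⟨?_, ?_, ?_⟩
  · -- `i' < i`, same row at `b`, different permutations
    exact erase_sum_lt_of_dominant d v ε (hθ hii') b (by rw [hpi, ← hcell, hpi'])
      (Or.inl (by rw [hpi', hpi]; exact hσ)) (hdom i') (hdom i)
  · exact Finset.sum_congr rfl fun x hx => by rw [hoff x (Finset.ne_of_mem_erase hx)]
  · exact erase_sum_lt_of_dominant d v ε (hθ hkk') b hcell (Or.inl (Ne.symm hσ)) (hdom k) (hdom k')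

end Chain

end RefreshExclusivity

end Summit.ValiantsHypothesis.ValiantsHypothesis.Theorems.KPlusLogSqLaw
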